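import Literature.Geometry.DiscreteGeometry.KissingSearchSearch
import HarnessLib

/-!
# The root normalisation of the kissing growth search, and the main abstract theorem

Topic `Literature/Geometry/DiscreteGeometry`; provefact brick for `Hales2012_contactGraphTame` /
`Hales2012_contactGraphFccOrHcp`, part 8.  Everything here is PROVED; nothing is named
(`KConf.contacts / longSpokes / Good`, `rootDomIdx`, `bitsOf` are defined in `KissingSearchDefs.lean`).

* Part A — in every `M : KConf` some label `v₀` has four contacts and at most one long side
  (`exists_root_vertex`: `Σ contacts ≥ 46`, `Σ long spokes ≤ 14`); a triangle `{v₀, p, q}` with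
  two contact spokes, and the further triangles `{v₀, p, p₃}`, `{v₀, q, p₄}` with `p₃ ≠ p₄`
  (`exists_good`);
* Part B — transport of this configuration (`Good`) along relabellings; five swaps bring it to
  the labels `0, 1, 2, 3, 4`, and the reflection `(1 2)(3 4)` enforces the tie-break
  (`exists_good_rootInv`);
* Part C — the root states: concrete facts about `mkRoot` (by `decide`), `realizes_mkRoot`, and
  **`concl_of_roots`**: if every root state searches `true`, every `M : KConf` has an FCC or HCP
  contact graph; with the parts: **`concl_of_parts`**.

## References
* T. C. Hales, arXiv:1209.6043 (2012), Lemma 7, Theorem 3 (proof: `#E₂(V) ∈ {23, 24}`).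
  [`Hales2012`]
-/

namespace Literature.Geometry.DiscreteGeometry

namespace KissingSearch

open Real Literature.Analysis.ValidatedNumerics KissingLP NonemptyInterval Finset

/-! ### Part A. A vertex with four contacts and at most one long side -/

section RootVertex

variable (M : KConf)



/-- `Σ_v #contacts(v) ≥ 46`. [cite: Hales2012, proof of Theorem 3] -/
theorem KConf.sum_card_contacts : 46 ≤ ∑ v ∈ Finset.range 12, (M.contacts v).card := by
  classical
  -- ordered contact pairs
  set P := ((Finset.range 12) ×ˢ (Finset.range 12)).filter fun p => p.1 ≠ p.2 ∧ M.g p.1 p.2 = 1 / 2 with hP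
  have hsum : ∑ v ∈ Finset.range 12, (M.contacts v).card = P.card := by
    rw [hP, Finset.card_filter, Finset.sum_product]
    refine Finset.sum_congr rfl fun v _ => ?_
    unfold KConf.contacts
    rw [Finset.card_filter]
    refine Finset.sum_congr rfl fun u _ => ?_
    by_cases h : u ≠ v ∧ M.g v u = 1 / 2
    · rw [if_pos h, if_pos ⟨Ne.symm h.1, h.2⟩]
    · rw [if_neg h, if_neg (fun h' => h ⟨Ne.symm h'.1, h'.2⟩)]
  rw [hsum]
  -- two copies of the unordered contact pairs inject into `P`
  set C := ((Finset.range 12) ×ˢ (Finset.range 12)).filter fun p => p.1 < p.2 ∧ M.g p.1 p.2 = 1 / 2 with hC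
  have h23 : 23 ≤ C.card := M.contacts_ge
  have hsub : C ∪ C.image Prod.swap ⊆ P := by
    intro p hp
    rw [Finset.mem_union, Finset.mem_image] at hp
    rw [hP, Finset.mem_filter, Finset.mem_product, Finset.mem_range, Finset.mem_range]
    rcases hp with hp | ⟨q, hq, rfl⟩
    · rw [hC, Finset.mem_filter, Finset.mem_product, Finset.mem_range, Finset.mem_range] at hp
      exact ⟨hp.1, ne_of_lt hp.2.1, hp.2.2⟩
    · rw [hC, Finset.mem_filter, Finset.mem_product, Finset.mem_range, Finset.mem_range] at hq
      simp only [Prod.fst_swap, Prod.snd_swap]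
      exact ⟨⟨hq.1.2, hq.1.1⟩, (ne_of_lt hq.2.1).symm, by rw [M.g_symm]; exact hq.2.2⟩
  have hdisj : Disjoint C (C.image Prod.swap) := by
    rw [Finset.disjoint_left]
    intro p hp hp'
    rw [Finset.mem_image] at hp'
    obtain ⟨q, hq, rfl⟩ := hp'
    rw [hC, Finset.mem_filter] at hp hq
    simp only [Prod.fst_swap, Prod.snd_swap] at hp
    exact lt_asymm hp.2.1 hq.2.1
  have := Finset.card_le_card hsub
  rw [Finset.card_union_of_disjoint hdisj, Finset.card_image_of_injective _ Prod.swap_injective] at this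
  omega

/-- `Σ_v #longSpokes(v) ≤ 14`. [cite: Hales2012, Lemma 7] -/
theorem KConf.sum_card_longSpokes : ∑ v ∈ Finset.range 12, (M.longSpokes v).card ≤ 14 := by
  classical
  -- ordered pairs `(v, u)` with `{v, u}` a long side
  have hsum : ∑ v ∈ Finset.range 12, (M.longSpokes v).card =
      (((Finset.range 12) ×ˢ (Finset.range 12)).filter fun p => ({p.1, p.2} : Finset ℕ) ∈ M.longSides).card := by
    rw [Finset.card_filter, Finset.sum_product]
    refine Finset.sum_congr rfl fun v _ => ?_
    unfold KConf.longSpokes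
    rw [Finset.card_filter]
  rw [hsum]
  -- each long side has exactly two ordered pairs
  have hle : (((Finset.range 12) ×ˢ (Finset.range 12)).filter fun p => ({p.1, p.2} : Finset ℕ) ∈ M.longSides).card ≤
      (M.longSides ×ˢ (Finset.range 2)).card := by
    refine Finset.card_le_card_of_injOn (fun p => (({p.1, p.2} : Finset ℕ), if p.1 < p.2 then 0 else 1)) ?_ ?_
    · intro p hp
      rw [Finset.mem_coe, Finset.mem_filter] at hp
      rw [Finset.mem_coe, Finset.mem_product, Finset.mem_range]
      refine ⟨hp.2, ?_⟩
      dsimp only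
      split_ifs <;> norm_num
    · intro p hp p' hp' e
      rw [Finset.mem_coe, Finset.mem_filter, Finset.mem_product, Finset.mem_range, Finset.mem_range] at hp hp'
      simp only [Prod.mk.injEq] at e
      obtain ⟨e1, e2⟩ := e
      -- long sides have two elements
      have hne : p.1 ≠ p.2 := by
        intro h
        have := hp.2
        unfold KConf.longSides at this
        rw [Finset.mem_filter, M.mem_sides, h] at this
        simp at this
      have hne' : p'.1 ≠ p'.2 := by
        intro h
        have := hp'.2
        unfold KConf.longSides at this
        rw [Finset.mem_filter, M.mem_sides, h] at this
        simp at this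
      have m1 : p.1 ∈ ({p'.1, p'.2} : Finset ℕ) := by rw [← e1]; simp
      have m2 : p.2 ∈ ({p'.1, p'.2} : Finset ℕ) := by rw [← e1]; simp
      simp only [Finset.mem_insert, Finset.mem_singleton] at m1 m2
      have hiff : (p.1 < p.2 ↔ p'.1 < p'.2) := by
        by_cases c1 : p.1 < p.2 <;> by_cases c2 : p'.1 < p'.2 <;> simp [c1, c2] at e2 ⊢
      apply Prod.ext <;> omega
  rw [Finset.card_product, Finset.card_range] at hle
  have := M.card_longSides_le
  omega

/-- **A root vertex**: four contacts and at most one long side. [cite: Hales2012, proof of Theorem 3] -/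
theorem KConf.exists_root_vertex : ∃ v, v < 12 ∧ (M.contacts v).card = 4 ∧ (M.longSpokes v).card ≤ 1 := by
  classical
  by_contra h
  push Not at h
  have hc4 : ∀ v, v < 12 → (M.contacts v).card ≤ 4 := fun v hv => M.cdeg_le v hv
  -- every vertex contributes at most `4` to `contacts + (4 - ...)`: if contacts = 4 then spokes ≥ 2
  have key : ∀ v ∈ Finset.range 12, 2 * (M.contacts v).card ≤ 6 + (M.longSpokes v).card := by
    intro v hv
    rw [Finset.mem_range] at hv
    have h1 := hc4 v hv
    by_cases h4 : (M.contacts v).card = 4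
    · have := h v hv h4; omega
    · omega
  have hs := Finset.sum_le_sum key
  rw [← Finset.mul_sum, Finset.sum_add_distrib, Finset.sum_const, Finset.card_range] at hs
  have h46 := M.sum_card_contacts
  have h14 := M.sum_card_longSpokes
  simp only [smul_eq_mul] at hs
  omega


/-- The triangles of `M` at `v` as a `KConf`-level set. [folklore] -/
theorem KConf.mem_filter_at {v : ℕ} {t : Finset ℕ} : t ∈ M.T.filter (fun t => v ∈ t) ↔ t ∈ M.T ∧ v ∈ t := Finset.mem_filter

/-- The other triangle on a side. [folklore] -/
theorem KConf.exists_other {t : Finset ℕ} (ht : t ∈ M.T) {a b : ℕ} (ha : a ∈ t) (hb : b ∈ t) (hab : a ≠ b) :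
    ∃ t' ∈ M.T, t' ≠ t ∧ a ∈ t' ∧ b ∈ t' := by
  classical
  have h2 := M.two t ht a ha b hb hab
  have hmem : t ∈ M.T.filter (fun t' => a ∈ t' ∧ b ∈ t') := Finset.mem_filter.2 ⟨ht, ha, hb⟩
  obtain ⟨t', ht', hne⟩ := Finset.exists_mem_ne (by rw [h2]; norm_num) t
  rw [Finset.mem_filter] at ht'
  exact ⟨t', ht'.1, hne, ht'.2.1, ht'.2.2⟩

/-- The third vertex of a triangle through two given labels. [folklore] -/
theorem KConf.exists_third_of_mem {t : Finset ℕ} (ht : t ∈ M.T) {a b : ℕ} (ha : a ∈ t) (hb : b ∈ t) (hab : a ≠ b) :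
    ∃ c, c < 12 ∧ c ≠ a ∧ c ≠ b ∧ t = {a, b, c} := by
  classical
  obtain ⟨hc3, hlt⟩ := M.mem_T t ht
  have hsub : ({a, b} : Finset ℕ) ⊆ t := by
    intro x hx; simp only [Finset.mem_insert, Finset.mem_singleton] at hx
    rcases hx with rfl | rfl
    · exact ha
    · exact hb
  have hcard : (t \ {a, b}).card = 1 := by rw [Finset.card_sdiff_of_subset hsub, hc3, Finset.card_pair hab]
  obtain ⟨c, hc⟩ := Finset.card_eq_one.1 hcard
  have hcm : c ∈ t \ {a, b} := by rw [hc]; simp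
  rw [Finset.mem_sdiff] at hcm
  simp only [Finset.mem_insert, Finset.mem_singleton, not_or] at hcm
  refine ⟨c, hlt c hcm.1, hcm.2.1, hcm.2.2, ?_⟩
  have : t = {a, b} ∪ (t \ {a, b}) := (Finset.union_sdiff_of_subset hsub).symm
  rw [this, hc]
  ext x; simp only [Finset.mem_union, Finset.mem_insert, Finset.mem_singleton]; tauto

/-- **Existence of the good configuration.** [cite: Hales2012, proof of Theorem 3] -/
theorem KConf.exists_good : ∃ v₀ p q p₃ p₄, M.Good v₀ p q p₃ p₄ := by
  classical
  obtain ⟨v₀, hv₀, hc4, hl1⟩ := M.exists_root_vertex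
  -- pairwise form of "at most one long side"
  have hpair : ∀ u w, ({v₀, u} : Finset ℕ) ∈ M.longSides → ({v₀, w} : Finset ℕ) ∈ M.longSides → u = w := by
    intro u w hu hw
    have mem : ∀ {x}, ({v₀, x} : Finset ℕ) ∈ M.longSides → x ∈ M.longSpokes v₀ := by
      intro x hx
      unfold KConf.longSpokes
      rw [Finset.mem_filter, Finset.mem_range]
      refine ⟨?_, hx⟩
      unfold KConf.longSides at hx
      rw [Finset.mem_filter, M.mem_sides] at hx
      obtain ⟨⟨-, t, ht, hsub⟩, -⟩ := hx
      exact (M.mem_T t ht).2 x (hsub (by simp))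
    exact Finset.card_le_one.1 hl1 u (mem hu) w (mem hw)
  -- the triangles at `v₀`; spokes
  -- a contact `p` of `v₀` (there are four)
  have hne : (M.contacts v₀).Nonempty := by rw [← Finset.card_pos, hc4]; norm_num
  obtain ⟨p₀, hp₀⟩ := hne
  unfold KConf.contacts at hp₀
  rw [Finset.mem_filter, Finset.mem_range] at hp₀
  obtain ⟨hp₀12, hp₀v, hgp₀⟩ := hp₀
  -- a triangle through `{v₀, p₀}`
  obtain ⟨t₁, ht₁, hv₁, hp₁⟩ := M.contact_side v₀ p₀ hv₀ hp₀12 (Ne.symm hp₀v) hgp₀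
  obtain ⟨q₁, hq₁12, hq₁v, hq₁p, rfl⟩ := M.exists_third_of_mem ht₁ hv₁ hp₁ (Ne.symm hp₀v)
  -- among the two triangles on the contact spoke `{v₀, p₀}`, one has its other spoke a contact:
  -- otherwise both other spokes are long sides through `v₀`, hence equal, hence the same triangle
  obtain ⟨t₂, ht₂, ht₂ne, hv₂, hp₂⟩ := M.exists_other ht₁ (show v₀ ∈ ({v₀, p₀, q₁} : Finset ℕ) by simp)
    (show p₀ ∈ ({v₀, p₀, q₁} : Finset ℕ) by simp) (Ne.symm hp₀v)
  obtain ⟨q₂, hq₂12, hq₂v, hq₂p, rfl⟩ := M.exists_third_of_mem ht₂ hv₂ hp₂ (Ne.symm hp₀v)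
  have long_of : ∀ {x : ℕ} {t : Finset ℕ}, t ∈ M.T → v₀ ∈ t → x ∈ t → x ≠ v₀ → x < 12 → M.g v₀ x ≠ 1 / 2 →
      ({v₀, x} : Finset ℕ) ∈ M.longSides := by
    intro x t ht hvt hxt hxv hx12 hg
    unfold KConf.longSides
    rw [Finset.mem_filter, M.mem_sides]
    refine ⟨⟨by rw [Finset.card_pair (Ne.symm hxv)], t, ht, ?_⟩, v₀, by simp, x, by simp, Ne.symm hxv, hg⟩
    intro y hy; simp only [Finset.mem_insert, Finset.mem_singleton] at hy
    rcases hy with rfl | rfl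
    · exact hvt
    · exact hxt
  -- choose `(p, q)` with both spokes contacts
  obtain ⟨p, q, hp12, hq12, hpv, hqv, hpq, hgp, hgq, hT⟩ : ∃ p q, p < 12 ∧ q < 12 ∧ p ≠ v₀ ∧ q ≠ v₀ ∧ p ≠ q ∧
      M.g v₀ p = 1 / 2 ∧ M.g v₀ q = 1 / 2 ∧ ({v₀, p, q} : Finset ℕ) ∈ M.T := by
    by_cases hg1 : M.g v₀ q₁ = 1 / 2
    · exact ⟨p₀, q₁, hp₀12, hq₁12, hp₀v, hq₁v, Ne.symm hq₁p, hgp₀, hg1, ht₁⟩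
    · by_cases hg2 : M.g v₀ q₂ = 1 / 2
      · exact ⟨p₀, q₂, hp₀12, hq₂12, hp₀v, hq₂v, Ne.symm hq₂p, hgp₀, hg2, ht₂⟩
      · exfalso
        have l1 := long_of ht₁ (by simp) (by simp) hq₁v hq₁12 hg1
        have l2 := long_of ht₂ (by simp) (by simp) hq₂v hq₂12 hg2
        have := hpair _ _ l1 l2
        exact ht₂ne (by rw [this])
  -- the other triangles on the two spokes
  obtain ⟨t₃, ht₃, ht₃ne, hv₃, hp₃⟩ := M.exists_other hT (show v₀ ∈ ({v₀, p, q} : Finset ℕ) by simp)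
    (show p ∈ ({v₀, p, q} : Finset ℕ) by simp) (Ne.symm hpv)
  obtain ⟨p₃, hp₃12, hp₃v, hp₃p, rfl⟩ := M.exists_third_of_mem ht₃ hv₃ hp₃ (Ne.symm hpv)
  obtain ⟨t₄, ht₄, ht₄ne, hv₄, hq₄⟩ := M.exists_other hT (show v₀ ∈ ({v₀, p, q} : Finset ℕ) by simp)
    (show q ∈ ({v₀, p, q} : Finset ℕ) by simp) (Ne.symm hqv)
  obtain ⟨p₄, hp₄12, hp₄v, hp₄q, rfl⟩ := M.exists_third_of_mem ht₄ hv₄ hq₄ (Ne.symm hqv)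
  have hp₃q : p₃ ≠ q := by rintro rfl; exact ht₃ne rfl
  have hp₄p : p₄ ≠ p := by
    rintro rfl; apply ht₄ne; ext x; simp only [Finset.mem_insert, Finset.mem_singleton]; tauto
  -- `p₃ ≠ p₄`: otherwise the three triangles are all the triangles at `v₀`, leaving three spokes
  have hp₃p₄ : p₃ ≠ p₄ := by
    intro e
    subst e
    -- the set of the three triangles is closed under side-sharing at `v₀`
    set A : Finset (Finset ℕ) := {{v₀, p, q}, {v₀, p, p₃}, {v₀, q, p₃}} with hA
    have hAsub : A ⊆ M.T.filter fun t => v₀ ∈ t := by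
      intro t ht
      rw [hA] at ht
      simp only [Finset.mem_insert, Finset.mem_singleton] at ht
      rw [Finset.mem_filter]
      rcases ht with rfl | rfl | rfl
      · exact ⟨hT, by simp⟩
      · exact ⟨ht₃, by simp⟩
      · exact ⟨ht₄, by simp⟩
    have hAne : A.Nonempty := ⟨{v₀, p, q}, by rw [hA]; exact Finset.mem_insert_self _ _⟩
    -- the two triangles on each of the three spokes are in `A`
    have onSpoke : ∀ {x : ℕ}, x ≠ v₀ → ∀ (ta tb : Finset ℕ), ta ∈ M.T → tb ∈ M.T → ta ≠ tb →
        v₀ ∈ ta → x ∈ ta → v₀ ∈ tb → x ∈ tb → ta ∈ A → tb ∈ A →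
        ∀ t' ∈ M.T, v₀ ∈ t' → x ∈ t' → t' ∈ A := by
      intro x hxv ta tb hta htb hne hva hxa hvb hxb haA hbA t' ht' hv' hx'
      have h2 := M.two ta hta v₀ hva x hxa (Ne.symm hxv)
      have hsub : ({ta, tb} : Finset (Finset ℕ)) ⊆ M.T.filter (fun t => v₀ ∈ t ∧ x ∈ t) := by
        intro t ht; simp only [Finset.mem_insert, Finset.mem_singleton] at ht
        rw [Finset.mem_filter]
        rcases ht with rfl | rfl
        · exact ⟨hta, hva, hxa⟩
        · exact ⟨htb, hvb, hxb⟩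
      have heq := Finset.eq_of_subset_of_card_le hsub (by rw [h2, Finset.card_pair hne])
      have : t' ∈ M.T.filter (fun t => v₀ ∈ t ∧ x ∈ t) := Finset.mem_filter.2 ⟨ht', hv', hx'⟩
      rw [← heq] at this
      simp only [Finset.mem_insert, Finset.mem_singleton] at this
      rcases this with rfl | rfl
      · exact haA
      · exact hbA
    have mA1 : ({v₀, p, q} : Finset ℕ) ∈ A := by rw [hA]; simp
    have mA2 : ({v₀, p, p₃} : Finset ℕ) ∈ A := by rw [hA]; simp
    have mA3 : ({v₀, q, p₃} : Finset ℕ) ∈ A := by rw [hA]; simp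
    have ne12 : ({v₀, p, q} : Finset ℕ) ≠ {v₀, p, p₃} := fun e => ht₃ne e.symm
    have ne13 : ({v₀, p, q} : Finset ℕ) ≠ {v₀, q, p₃} := fun e => ht₄ne e.symm
    have ne23 : ({v₀, p, p₃} : Finset ℕ) ≠ {v₀, q, p₃} := by
      intro e
      have : p ∈ ({v₀, q, p₃} : Finset ℕ) := by rw [← e]; simp
      simp only [Finset.mem_insert, Finset.mem_singleton] at this
      rcases this with h | h | h
      · exact hpv h
      · exact hpq h
      · exact hp₃p h.symm
    have hcl : ∀ t ∈ A, ∀ t' ∈ M.T, v₀ ∈ t' → (t ∩ t').card = 2 → t' ∈ A := by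
      intro t ht t' ht' hv' h2
      obtain ⟨x, hxv, hx, hx'⟩ := exists_common_of_inter_two v₀ h2
      rw [hA] at ht
      simp only [Finset.mem_insert, Finset.mem_singleton] at ht
      rcases ht with rfl | rfl | rfl
      · simp only [Finset.mem_insert, Finset.mem_singleton] at hx
        rcases hx with h | rfl | rfl
        · exact absurd h hxv
        · exact onSpoke hxv _ _ hT ht₃ ne12 (by simp) (by simp) (by simp) (by simp) mA1 mA2 t' ht' hv' hx'
        · exact onSpoke hxv _ _ hT ht₄ ne13 (by simp) (by simp) (by simp) (by simp) mA1 mA3 t' ht' hv' hx'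
      · simp only [Finset.mem_insert, Finset.mem_singleton] at hx
        rcases hx with h | rfl | rfl
        · exact absurd h hxv
        · exact onSpoke hxv _ _ hT ht₃ ne12 (by simp) (by simp) (by simp) (by simp) mA1 mA2 t' ht' hv' hx'
        · exact onSpoke hxv _ _ ht₃ ht₄ ne23 (by simp) (by simp) (by simp) (by simp) mA2 mA3 t' ht' hv' hx'
      · simp only [Finset.mem_insert, Finset.mem_singleton] at hx
        rcases hx with h | rfl | rfl
        · exact absurd h hxv
        · exact onSpoke hxv _ _ hT ht₄ ne13 (by simp) (by simp) (by simp) (by simp) mA1 mA3 t' ht' hv' hx'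
        · exact onSpoke hxv _ _ ht₃ ht₄ ne23 (by simp) (by simp) (by simp) (by simp) mA2 mA3 t' ht' hv' hx'
    have hAeq := M.link v₀ hv₀ A hAsub hAne hcl
    -- the four contacts of `v₀` are spokes, i.e. in `{p, q, p₃}`
    have spokes : ∀ u ∈ M.contacts v₀, u ∈ ({p, q, p₃} : Finset ℕ) := by
      intro u hu
      unfold KConf.contacts at hu
      rw [Finset.mem_filter, Finset.mem_range] at hu
      obtain ⟨hu12, huv, hgu⟩ := hu
      obtain ⟨t, ht, hvt, hut⟩ := M.contact_side v₀ u hv₀ hu12 (Ne.symm huv) hgu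
      have : t ∈ A := by rw [hAeq, Finset.mem_filter]; exact ⟨ht, hvt⟩
      rw [hA] at this
      simp only [Finset.mem_insert, Finset.mem_singleton] at this
      rcases this with rfl | rfl | rfl <;> simp only [Finset.mem_insert, Finset.mem_singleton] at hut ⊢ <;> omega
    have := Finset.card_le_card (show M.contacts v₀ ⊆ ({p, q, p₃} : Finset ℕ) from spokes)
    rw [hc4] at this
    have h3 : (({p, q, p₃} : Finset ℕ)).card ≤ 3 := Finset.card_le_three
    omega
  exact ⟨v₀, p, q, p₃, p₄, hv₀, hp12, hq12, hp₃12, hp₄12, Ne.symm hpv, Ne.symm hqv, Ne.symm hp₃v, Ne.symm hp₄v, hpq,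
    Ne.symm hp₃p, Ne.symm hp₄p, Ne.symm hp₃q |>.symm |> Ne.symm, Ne.symm hp₄q, hp₃p₄, hgp, hgq, hT, ht₃, ht₄, hc4, hpair⟩

end RootVertex

/-! ### Part B. Transport of the good configuration; normalisation to the labels `0 … 4` -/

section Transport

variable (M : KConf)

/-- A swap of two labels `< 12` preserves `[0, 12)`. [folklore] -/
theorem swap_lt_iff {a b : ℕ} (ha : a < 12) (hb : b < 12) (x : ℕ) : (Equiv.swap a b) x < 12 ↔ x < 12 := by
  by_cases h1 : x = a
  · subst h1; rw [Equiv.swap_apply_left]; exact ⟨fun _ => ha, fun _ => hb⟩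
  · by_cases h2 : x = b
    · subst h2; rw [Equiv.swap_apply_right]; exact ⟨fun _ => hb, fun _ => ha⟩
    · rw [Equiv.swap_apply_of_ne_of_ne h1 h2]

/-- Long sides of the relabelled structure. [folklore] -/
theorem KConf.mem_longSides_relabel (σ : Equiv.Perm ℕ) (hσ : ∀ a, σ a < 12 ↔ a < 12) {e : Finset ℕ} :
    e ∈ (M.relabel σ hσ).longSides ↔ relab σ.symm e ∈ M.longSides := by
  unfold KConf.longSides
  rw [Finset.mem_filter, Finset.mem_filter, KConf.mem_sides, KConf.mem_sides]
  constructor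
  · rintro ⟨⟨hc, t, ht, hsub⟩, p, hp, q, hq, hpq, hg⟩
    change t ∈ M.T.image (relab σ) at ht
    rw [Finset.mem_image] at ht
    obtain ⟨t₀, ht₀, rfl⟩ := ht
    refine ⟨⟨by rw [card_relab, hc], t₀, ht₀, fun x hx => ?_⟩, σ.symm p, (mem_relab_iff σ.symm).2 (by simpa using hp),
      σ.symm q, (mem_relab_iff σ.symm).2 (by simpa using hq), fun e => hpq (σ.symm.injective e), hg⟩
    rw [mem_relab_iff] at hx
    simp only [Equiv.symm_symm] at hx
    have := hsub hx
    rw [mem_relab_iff] at this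
    simpa using this
  · rintro ⟨⟨hc, t₀, ht₀, hsub⟩, p, hp, q, hq, hpq, hg⟩
    rw [card_relab] at hc
    rw [mem_relab_iff] at hp hq
    simp only [Equiv.symm_symm] at hp hq
    refine ⟨⟨hc, relab σ t₀, Finset.mem_image_of_mem _ ht₀, fun x hx => ?_⟩, σ p, hp, σ q, hq,
      fun e => hpq (σ.injective e), ?_⟩
    · rw [mem_relab_iff]
      exact hsub ((mem_relab_iff σ.symm).2 (by simpa using hx))
    · show M.g (σ.symm (σ p)) (σ.symm (σ q)) ≠ 1 / 2
      simpa using hg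

/-- **Transport of the good configuration along a relabelling.** [folklore] -/
theorem KConf.good_relabel (σ : Equiv.Perm ℕ) (hσ : ∀ a, σ a < 12 ↔ a < 12) {v₀ p q p₃ p₄ : ℕ}
    (G : M.Good v₀ p q p₃ p₄) : (M.relabel σ hσ).Good (σ v₀) (σ p) (σ q) (σ p₃) (σ p₄) := by
  classical
  obtain ⟨hv, hp, hq, h3, h4, n1, n2, n3, n4, n5, n6, n7, n8, n9, n10, g1, g2, T1, T2, T3, hc4, hpair⟩ := G
  have inj := σ.injective
  have gg : ∀ a b, (M.relabel σ hσ).g (σ a) (σ b) = M.g a b := fun a b => by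
    show M.g (σ.symm (σ a)) (σ.symm (σ b)) = M.g a b; simp
  have tt : ∀ a b c, ({a, b, c} : Finset ℕ) ∈ M.T → ({σ a, σ b, σ c} : Finset ℕ) ∈ (M.relabel σ hσ).T := by
    intro a b c h
    show ({σ a, σ b, σ c} : Finset ℕ) ∈ M.T.image (relab σ)
    rw [Finset.mem_image]
    exact ⟨{a, b, c}, h, by unfold relab; simp [Finset.image_insert, Finset.image_singleton]⟩
  refine ⟨(hσ _).2 hv, (hσ _).2 hp, (hσ _).2 hq, (hσ _).2 h3, (hσ _).2 h4, inj.ne n1, inj.ne n2, inj.ne n3, inj.ne n4,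
    inj.ne n5, inj.ne n6, inj.ne n7, inj.ne n8, inj.ne n9, inj.ne n10, by rw [gg]; exact g1, by rw [gg]; exact g2,
    tt _ _ _ T1, tt _ _ _ T2, tt _ _ _ T3, ?_, ?_⟩
  · rw [← hc4]
    symm
    refine Finset.card_bij (fun u _ => σ u) ?_ ?_ ?_
    · intro u hu
      unfold KConf.contacts at hu ⊢
      rw [Finset.mem_filter, Finset.mem_range] at hu ⊢
      exact ⟨(hσ u).2 hu.1, inj.ne hu.2.1, by rw [gg]; exact hu.2.2⟩
    · intro u _ u' _ e; exact inj e
    · intro w hw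
      unfold KConf.contacts at hw
      rw [Finset.mem_filter, Finset.mem_range] at hw
      refine ⟨σ.symm w, ?_, by simp⟩
      unfold KConf.contacts
      rw [Finset.mem_filter, Finset.mem_range, symm_lt_iff σ hσ]
      refine ⟨hw.1, fun e => hw.2.1 (by rw [← e]; simp), ?_⟩
      have := hw.2.2
      change M.g (σ.symm (σ v₀)) (σ.symm w) = 1 / 2 at this
      simpa using this
  · intro u w hu hw
    rw [KConf.mem_longSides_relabel] at hu hw
    unfold relab at hu hw
    simp only [Finset.image_insert, Finset.image_singleton, Equiv.symm_apply_apply] at hu hw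
    have := hpair _ _ hu hw
    exact σ.symm.injective this

/-- Swapping the roles `(p, p₃) ↔ (q, p₄)`. [folklore] -/
theorem KConf.good_swap_roles {v₀ p q p₃ p₄ : ℕ} (G : M.Good v₀ p q p₃ p₄) : M.Good v₀ q p p₄ p₃ := by
  obtain ⟨hv, hp, hq, h3, h4, n1, n2, n3, n4, n5, n6, n7, n8, n9, n10, g1, g2, T1, T2, T3, hc4, hpair⟩ := G
  refine ⟨hv, hq, hp, h4, h3, n2, n1, n4, n3, n5.symm, n9, n8, n7, n6, n10.symm, g2, g1, ?_, T3, T2, hc4, hpair⟩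
  have : ({v₀, q, p} : Finset ℕ) = {v₀, p, q} := by
    ext x; simp only [Finset.mem_insert, Finset.mem_singleton]; tauto
  rw [this]; exact T1

/-- The four-contacts part of `Good`. [folklore] -/
theorem KConf.Good.contacts_eq {v₀ p q p₃ p₄ : ℕ} (G : M.Good v₀ p q p₃ p₄) : (M.contacts v₀).card = 4 :=
  G.2.2.2.2.2.2.2.2.2.2.2.2.2.2.2.2.2.2.2.2.1

/-- The one-long-side part of `Good`. [folklore] -/
theorem KConf.Good.longSides_eq {v₀ p q p₃ p₄ : ℕ} (G : M.Good v₀ p q p₃ p₄) :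
    ∀ u w, ({v₀, u} : Finset ℕ) ∈ M.longSides → ({v₀, w} : Finset ℕ) ∈ M.longSides → u = w :=
  G.2.2.2.2.2.2.2.2.2.2.2.2.2.2.2.2.2.2.2.2.2

/-- **Normalisation**: a structure with the same conclusion, in good position at the labels
`0, 1, 2, 3, 4` and satisfying the root normalisation. [folklore] -/
theorem KConf.exists_good_rootInv : ∃ M' : KConf, (M'.Concl → M.Concl) ∧ M'.Good 0 1 2 3 4 ∧ M'.RootInv := by
  classical
  obtain ⟨v₀, p, q, p₃, p₄, G⟩ := M.exists_good
  -- five swaps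
  have hv : v₀ < 12 := G.1
  have hσ₁ := swap_lt_iff hv (by norm_num : 0 < 12)
  have G₁ := M.good_relabel (Equiv.swap v₀ 0) hσ₁ G
  rw [Equiv.swap_apply_left] at G₁
  have hp₁ : (Equiv.swap v₀ 0) p < 12 := G₁.2.1
  have n01 : (0 : ℕ) ≠ (Equiv.swap v₀ 0) p := G₁.2.2.2.2.2.1
  have hσ₂ := swap_lt_iff hp₁ (by norm_num : 1 < 12)
  have G₂ := (M.relabel _ hσ₁).good_relabel (Equiv.swap ((Equiv.swap v₀ 0) p) 1) hσ₂ G₁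
  rw [Equiv.swap_apply_left, Equiv.swap_apply_of_ne_of_ne n01 (by norm_num)] at G₂
  -- name the current images
  generalize hq₂ : (Equiv.swap ((Equiv.swap v₀ 0) p) 1) ((Equiv.swap v₀ 0) q) = q₂ at G₂
  generalize hr₂ : (Equiv.swap ((Equiv.swap v₀ 0) p) 1) ((Equiv.swap v₀ 0) p₃) = r₂ at G₂
  generalize hs₂ : (Equiv.swap ((Equiv.swap v₀ 0) p) 1) ((Equiv.swap v₀ 0) p₄) = s₂ at G₂
  have hq₂lt : q₂ < 12 := G₂.2.2.1
  have n02 : (0 : ℕ) ≠ q₂ := G₂.2.2.2.2.2.2.1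
  have n12 : (1 : ℕ) ≠ q₂ := G₂.2.2.2.2.2.2.2.2.2.1
  have hσ₃ := swap_lt_iff hq₂lt (by norm_num : 2 < 12)
  have G₃ := ((M.relabel _ hσ₁).relabel _ hσ₂).good_relabel (Equiv.swap q₂ 2) hσ₃ G₂
  rw [Equiv.swap_apply_left, Equiv.swap_apply_of_ne_of_ne n02 (by norm_num),
    Equiv.swap_apply_of_ne_of_ne n12 (by norm_num)] at G₃
  generalize hr₃ : (Equiv.swap q₂ 2) r₂ = r₃ at G₃
  generalize hs₃ : (Equiv.swap q₂ 2) s₂ = s₃ at G₃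
  have hr₃lt : r₃ < 12 := G₃.2.2.2.1
  have n03 : (0 : ℕ) ≠ r₃ := G₃.2.2.2.2.2.2.2.1
  have n13 : (1 : ℕ) ≠ r₃ := G₃.2.2.2.2.2.2.2.2.2.2.1
  have n23 : (2 : ℕ) ≠ r₃ := G₃.2.2.2.2.2.2.2.2.2.2.2.2.1
  have hσ₄ := swap_lt_iff hr₃lt (by norm_num : 3 < 12)
  have G₄ := (((M.relabel _ hσ₁).relabel _ hσ₂).relabel _ hσ₃).good_relabel (Equiv.swap r₃ 3) hσ₄ G₃
  rw [Equiv.swap_apply_left, Equiv.swap_apply_of_ne_of_ne n03 (by norm_num),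
    Equiv.swap_apply_of_ne_of_ne n13 (by norm_num), Equiv.swap_apply_of_ne_of_ne n23 (by norm_num)] at G₄
  generalize hs₄ : (Equiv.swap r₃ 3) s₃ = s₄ at G₄
  have hs₄lt : s₄ < 12 := G₄.2.2.2.2.1
  have n04 : (0 : ℕ) ≠ s₄ := G₄.2.2.2.2.2.2.2.2.1
  have n14 : (1 : ℕ) ≠ s₄ := G₄.2.2.2.2.2.2.2.2.2.2.2.1
  have n24 : (2 : ℕ) ≠ s₄ := G₄.2.2.2.2.2.2.2.2.2.2.2.2.2.1
  have n34 : (3 : ℕ) ≠ s₄ := G₄.2.2.2.2.2.2.2.2.2.2.2.2.2.2.1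
  have hσ₅ := swap_lt_iff hs₄lt (by norm_num : 4 < 12)
  have G₅ := ((((M.relabel _ hσ₁).relabel _ hσ₂).relabel _ hσ₃).relabel _ hσ₄).good_relabel (Equiv.swap s₄ 4) hσ₅ G₄
  rw [Equiv.swap_apply_left, Equiv.swap_apply_of_ne_of_ne n04 (by norm_num),
    Equiv.swap_apply_of_ne_of_ne n14 (by norm_num), Equiv.swap_apply_of_ne_of_ne n24 (by norm_num),
    Equiv.swap_apply_of_ne_of_ne n34 (by norm_num)] at G₅
  set M₅ := ((((M.relabel _ hσ₁).relabel _ hσ₂).relabel _ hσ₃).relabel _ hσ₄).relabel _ hσ₅ with hM₅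
  have back : M₅.Concl → M.Concl := fun h =>
    M.concl_of_relabel _ hσ₁ ((M.relabel _ hσ₁).concl_of_relabel _ hσ₂ (((M.relabel _ hσ₁).relabel _ hσ₂).concl_of_relabel _ hσ₃
      ((((M.relabel _ hσ₁).relabel _ hσ₂).relabel _ hσ₃).concl_of_relabel _ hσ₄
        (((((M.relabel _ hσ₁).relabel _ hσ₂).relabel _ hσ₃).relabel _ hσ₄).concl_of_relabel _ hσ₅ h))))
  -- the tie-break, by the reflection `(1 2)(3 4)` if needed
  by_cases htb : ¬ (M₅.ty 0 4 < M₅.ty 0 3 ∨ (M₅.ty 0 3 = M₅.ty 0 4 ∧ M₅.ty 2 4 < M₅.ty 1 3))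
  · exact ⟨M₅, back, G₅, G₅.contacts_eq, G₅.longSides_eq, htb⟩
  · push Not at htb
    set τ : Equiv.Perm ℕ := Equiv.swap 1 2 * Equiv.swap 3 4 with hτ
    have τ0 : τ 0 = 0 := by rw [hτ, Equiv.Perm.mul_apply]; decide
    have τ1 : τ 1 = 2 := by rw [hτ, Equiv.Perm.mul_apply]; decide
    have τ2 : τ 2 = 1 := by rw [hτ, Equiv.Perm.mul_apply]; decide
    have τ3 : τ 3 = 4 := by rw [hτ, Equiv.Perm.mul_apply]; decide
    have τ4 : τ 4 = 3 := by rw [hτ, Equiv.Perm.mul_apply]; decide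
    have hτσ : ∀ a, τ a < 12 ↔ a < 12 := by
      intro a; rw [hτ, Equiv.Perm.mul_apply, swap_lt_iff (by norm_num) (by norm_num), swap_lt_iff (by norm_num) (by norm_num)]
    have G₆ := M₅.good_relabel τ hτσ G₅
    rw [τ0, τ1, τ2, τ3, τ4] at G₆
    have G₆' := (M₅.relabel τ hτσ).good_swap_roles G₆
    refine ⟨M₅.relabel τ hτσ, fun h => back (M₅.concl_of_relabel τ hτσ h), G₆', G₆'.contacts_eq, G₆'.longSides_eq, ?_⟩
    -- the types are exchanged
    have hty : ∀ a b, (M₅.relabel τ hτσ).ty a b = M₅.ty (τ.symm a) (τ.symm b) := fun a b => rfl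
    have s0 : τ.symm 0 = 0 := by rw [Equiv.symm_apply_eq]; exact τ0.symm
    have s1 : τ.symm 1 = 2 := by rw [Equiv.symm_apply_eq]; exact τ2.symm
    have s2 : τ.symm 2 = 1 := by rw [Equiv.symm_apply_eq]; exact τ1.symm
    have s3 : τ.symm 3 = 4 := by rw [Equiv.symm_apply_eq]; exact τ4.symm
    have s4 : τ.symm 4 = 3 := by rw [Equiv.symm_apply_eq]; exact τ3.symm
    rw [hty, hty, hty, hty, s0, s1, s2, s3, s4]
    omega

end Transport

/-! ### Part C. The root states realize; the main abstract theorem -/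

section Main


/-- The triangles of a root state. [folklore] -/
theorem mkRoot_tris (m bits : ℕ) : (mkRoot m bits).tris = #[triCode 0 1 2, triCode 0 1 3, triCode 0 2 4] := rfl

set_option maxRecDepth 8192 in
/-- The array sizes of a root state. [folklore] -/
theorem mkRoot_sizes : ∀ m < 2, ∀ bits < 16, (mkRoot m bits).dom.size = 144 ∧ (mkRoot m bits).sc.size = 144 := by
  decide

set_option maxRecDepth 8192 in
/-- The domains of a root state. [folklore] -/
theorem mkRoot_gdom : ∀ m < 2, ∀ bits < 16, ∀ i < 144, (mkRoot m bits).dom.getD i UNL = rootDomIdx m bits i := by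
  decide +kernel

set_option maxRecDepth 8192 in
/-- The cached side counts of a root state are the true counts. [folklore] -/
theorem mkRoot_gsc : ∀ m < 2, ∀ bits < 16, ∀ p < 12, ∀ q < 12, p ≠ q →
    (mkRoot m bits).gsc p q = ((mkRoot m bits).tris.toList.filter fun t => tmem t p && tmem t q).length := by
  decide +kernel

/-- The three root codes are valid and have the expected vertex sets. [folklore] -/
theorem root_codes : (TriValid (triCode 0 1 2) ∧ tset (triCode 0 1 2) = {0, 1, 2}) ∧
    (TriValid (triCode 0 1 3) ∧ tset (triCode 0 1 3) = {0, 1, 3}) ∧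
    (TriValid (triCode 0 2 4) ∧ tset (triCode 0 2 4) = {0, 2, 4}) := by
  refine ⟨⟨by unfold TriValid; decide, by decide⟩, ⟨by unfold TriValid; decide, by decide⟩,
    ⟨by unfold TriValid; decide, by decide⟩⟩

variable {M : KConf}


/-- Types are `0` or `1`. [folklore] -/
theorem KConf.ty_le_one (M : KConf) (p q : ℕ) : M.ty p q ≤ 1 := by unfold KConf.ty; split_ifs <;> norm_num

/-- Decoding the bits. [folklore] -/
theorem bitsOf_decode (M : KConf) : bitsOf M % 2 = M.ty 0 3 ∧ (bitsOf M / 2) % 2 = M.ty 1 3 ∧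
    (bitsOf M / 4) % 2 = M.ty 0 4 ∧ (bitsOf M / 8) % 2 = M.ty 2 4 ∧ bitsOf M < 16 := by
  unfold bitsOf
  have := M.ty_le_one 0 3; have := M.ty_le_one 1 3; have := M.ty_le_one 0 4; have := M.ty_le_one 2 4
  omega

/-- A label pair of a triangle of `M`: the code `if ty = 0 then 0 else FULLR` means the truth.
[folklore] -/
theorem domSem_lab (M : KConf) {p q : ℕ} (hp : p < 12) (hq : q < 12) (hpq : p ≠ q) {t : Finset ℕ} (hT : t ∈ M.T)
    (hpt : p ∈ t) (hqt : q ∈ t) : DomSem (if M.ty p q = 0 then 0 else FULLR) (M.g p q) := by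
  unfold KConf.ty
  by_cases hg : M.g p q = 1 / 2
  · rw [if_pos hg, if_pos rfl]; exact Or.inr (Or.inl ⟨rfl, hg⟩)
  · rw [if_neg hg, if_neg (by norm_num)]
    refine Or.inr (Or.inr ⟨validDom_mkR le_rfl (by unfold K; norm_num) le_rfl, by unfold FULLR mkR; norm_num, hg, ?_, ?_⟩)
    · rw [show rLo FULLR = 1 by unfold rLo FULLR mkR K; norm_num]
      have : gridPt (1 - 1) = -1 / 2 := by unfold gridPt; simp
      rw [this]
      have := M.side_bound t hT p hpt q hqt hpq
      push_cast; linarith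
    · rw [show rHi FULLR = K by unfold rHi FULLR mkR K; norm_num]
      have : gridPt K = κ0 := by unfold gridPt K; ring
      rw [this]
      rcases M.dichot p q hp hq hpq with h | ⟨-, h⟩
      · exact absurd h hg
      · exact h

/-- **The root state of a structure in good position is realized by it.** [folklore] -/
theorem realizes_mkRoot (G : M.Good 0 1 2 3 4) : Realizes M (mkRoot (M.ty 1 2) (bitsOf M)) := by
  classical
  obtain ⟨-, -, -, -, -, -, -, -, -, -, -, -, -, -, -, g1, g2, T1, T2, T3, -, -⟩ := G
  have hm : M.ty 1 2 < 2 := by have := M.ty_le_one 1 2; omega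
  obtain ⟨d1, d2, d3, d4, hb⟩ := bitsOf_decode M
  obtain ⟨hszd, hszs⟩ := mkRoot_sizes _ hm _ hb
  obtain ⟨⟨v1, s1⟩, ⟨v2, s2⟩, ⟨v3, s3⟩⟩ := root_codes
  have htris : (mkRoot (M.ty 1 2) (bitsOf M)).tris.toList = [triCode 0 1 2, triCode 0 1 3, triCode 0 2 4] := by
    rw [mkRoot_tris]
  -- domains
  have hgd : ∀ p q, p < 12 → q < 12 →
      (mkRoot (M.ty 1 2) (bitsOf M)).gdom p q = rootDomIdx (M.ty 1 2) (bitsOf M) (sIdx p q) := by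
    intro p q hp hq
    have h := mkRoot_gdom _ hm _ hb _ (sIdx_lt hp hq)
    unfold St.gdom
    exact h
  -- the meaning of the root domain at a pair
  have sem : ∀ p q, p < 12 → q < 12 → p ≠ q →
      DomSem (rootDomIdx (M.ty 1 2) (bitsOf M) (sIdx p q)) (M.g p q) ∧
      (rootDomIdx (M.ty 1 2) (bitsOf M) (sIdx p q) ≠ UNL →
        ∃ t ∈ [triCode 0 1 2, triCode 0 1 3, triCode 0 2 4], p ∈ tset t ∧ q ∈ tset t) := by
    intro p q hp hq hpq
    unfold rootDomIdx
    simp only [d1, d2, d3, d4]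
    have e01 := sIdx_eq_iff hp hq (by norm_num : 0 < 12) (by norm_num : 1 < 12)
    have e02 := sIdx_eq_iff hp hq (by norm_num : 0 < 12) (by norm_num : 2 < 12)
    have e12 := sIdx_eq_iff hp hq (by norm_num : 1 < 12) (by norm_num : 2 < 12)
    have e03 := sIdx_eq_iff hp hq (by norm_num : 0 < 12) (by norm_num : 3 < 12)
    have e13 := sIdx_eq_iff hp hq (by norm_num : 1 < 12) (by norm_num : 3 < 12)
    have e04 := sIdx_eq_iff hp hq (by norm_num : 0 < 12) (by norm_num : 4 < 12)
    have e24 := sIdx_eq_iff hp hq (by norm_num : 2 < 12) (by norm_num : 4 < 12)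
    -- membership in a root triangle from the pair
    have side : ∀ {a b : ℕ} {t : ℕ}, tset t = ({0, a, b} : Finset ℕ) →
        ((p = 0 ∧ q = a ∨ p = a ∧ q = 0) ∨ (p = 0 ∧ q = b ∨ p = b ∧ q = 0) ∨ (p = a ∧ q = b ∨ p = b ∧ q = a)) →
        p ∈ tset t ∧ q ∈ tset t := by
      intro a b t ht h
      rw [ht]
      simp only [Finset.mem_insert, Finset.mem_singleton]
      omega
    -- the contact or long code of a side of a triangle of `M`
    have lab : ∀ {a b : ℕ} {t : Finset ℕ}, t ∈ M.T → a ∈ t → b ∈ t → a < 12 → b < 12 → a ≠ b →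
        ((p = a ∧ q = b) ∨ (p = b ∧ q = a)) → DomSem (if M.ty a b = 0 then 0 else FULLR) (M.g p q) := by
      intro a b t hT hat hbt ha hb' hab h
      rcases h with ⟨rfl, rfl⟩ | ⟨rfl, rfl⟩
      · exact domSem_lab M ha hb' hab hT hat hbt
      · rw [M.g_symm]; exact domSem_lab M ha hb' hab hT hat hbt
    by_cases c01 : sIdx p q = sIdx 0 1
    · rw [if_pos c01]
      refine ⟨?_, fun _ => ⟨triCode 0 1 2, by simp, side s1 (Or.inl (e01.1 c01))⟩⟩
      rcases e01.1 c01 with ⟨rfl, rfl⟩ | ⟨rfl, rfl⟩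
      · exact Or.inr (Or.inl ⟨rfl, g1⟩)
      · exact Or.inr (Or.inl ⟨rfl, by rw [M.g_symm]; exact g1⟩)
    rw [if_neg c01]
    by_cases c02 : sIdx p q = sIdx 0 2
    · rw [if_pos c02]
      refine ⟨?_, fun _ => ⟨triCode 0 1 2, by simp, side s1 (Or.inr (Or.inl (e02.1 c02)))⟩⟩
      rcases e02.1 c02 with ⟨rfl, rfl⟩ | ⟨rfl, rfl⟩
      · exact Or.inr (Or.inl ⟨rfl, g2⟩)
      · exact Or.inr (Or.inl ⟨rfl, by rw [M.g_symm]; exact g2⟩)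
    rw [if_neg c02]
    by_cases c12 : sIdx p q = sIdx 1 2
    · rw [if_pos c12]
      exact ⟨lab T1 (by simp) (by simp) (by norm_num) (by norm_num) (by norm_num) (e12.1 c12),
        fun _ => ⟨triCode 0 1 2, by simp, side s1 (Or.inr (Or.inr (e12.1 c12)))⟩⟩
    rw [if_neg c12]
    by_cases c03 : sIdx p q = sIdx 0 3
    · rw [if_pos c03]
      exact ⟨lab T2 (by simp) (by simp) (by norm_num) (by norm_num) (by norm_num) (e03.1 c03),
        fun _ => ⟨triCode 0 1 3, by simp, side s2 (Or.inr (Or.inl (e03.1 c03)))⟩⟩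
    rw [if_neg c03]
    by_cases c13 : sIdx p q = sIdx 1 3
    · rw [if_pos c13]
      exact ⟨lab T2 (by simp) (by simp) (by norm_num) (by norm_num) (by norm_num) (e13.1 c13),
        fun _ => ⟨triCode 0 1 3, by simp, side s2 (Or.inr (Or.inr (e13.1 c13)))⟩⟩
    rw [if_neg c13]
    by_cases c04 : sIdx p q = sIdx 0 4
    · rw [if_pos c04]
      exact ⟨lab T3 (by simp) (by simp) (by norm_num) (by norm_num) (by norm_num) (e04.1 c04),
        fun _ => ⟨triCode 0 2 4, by simp, side s3 (Or.inr (Or.inl (e04.1 c04)))⟩⟩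
    rw [if_neg c04]
    by_cases c24 : sIdx p q = sIdx 2 4
    · rw [if_pos c24]
      exact ⟨lab T3 (by simp) (by simp) (by norm_num) (by norm_num) (by norm_num) (e24.1 c24),
        fun _ => ⟨triCode 0 2 4, by simp, side s3 (Or.inr (Or.inr (e24.1 c24)))⟩⟩
    rw [if_neg c24]
    exact ⟨Or.inl rfl, fun h => absurd rfl h⟩
  -- codes of the seven sides are not `UNL`
  have labne : ∀ t, (if t = 0 then 0 else FULLR) ≠ UNL := by
    intro t; split_ifs <;> decide
  have ne_of : ∀ i, (i = sIdx 0 1 ∨ i = sIdx 0 2 ∨ i = sIdx 1 2 ∨ i = sIdx 0 3 ∨ i = sIdx 1 3 ∨ i = sIdx 0 4 ∨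
      i = sIdx 2 4) → rootDomIdx (M.ty 1 2) (bitsOf M) i ≠ UNL := by
    have h0 : (0 : ℕ) ≠ UNL := by decide
    intro i hi
    unfold rootDomIdx
    simp only
    rcases hi with rfl | rfl | rfl | rfl | rfl | rfl | rfl
    · rw [if_pos rfl]
      exact h0
    · rw [if_neg (show ¬ (sIdx 0 2 = sIdx 0 1) by decide), if_pos rfl]
      exact h0
    · rw [if_neg (show ¬ (sIdx 1 2 = sIdx 0 1) by decide), if_neg (show ¬ (sIdx 1 2 = sIdx 0 2) by decide), if_pos rfl]
      exact labne _
    · rw [if_neg (show ¬ (sIdx 0 3 = sIdx 0 1) by decide), if_neg (show ¬ (sIdx 0 3 = sIdx 0 2) by decide), if_neg (show ¬ (sIdx 0 3 = sIdx 1 2) by decide), if_pos rfl]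
      exact labne _
    · rw [if_neg (show ¬ (sIdx 1 3 = sIdx 0 1) by decide), if_neg (show ¬ (sIdx 1 3 = sIdx 0 2) by decide), if_neg (show ¬ (sIdx 1 3 = sIdx 1 2) by decide), if_neg (show ¬ (sIdx 1 3 = sIdx 0 3) by decide), if_pos rfl]
      exact labne _
    · rw [if_neg (show ¬ (sIdx 0 4 = sIdx 0 1) by decide), if_neg (show ¬ (sIdx 0 4 = sIdx 0 2) by decide), if_neg (show ¬ (sIdx 0 4 = sIdx 1 2) by decide), if_neg (show ¬ (sIdx 0 4 = sIdx 0 3) by decide), if_neg (show ¬ (sIdx 0 4 = sIdx 1 3) by decide), if_pos rfl]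
      exact labne _
    · rw [if_neg (show ¬ (sIdx 2 4 = sIdx 0 1) by decide), if_neg (show ¬ (sIdx 2 4 = sIdx 0 2) by decide), if_neg (show ¬ (sIdx 2 4 = sIdx 1 2) by decide), if_neg (show ¬ (sIdx 2 4 = sIdx 0 3) by decide), if_neg (show ¬ (sIdx 2 4 = sIdx 1 3) by decide), if_neg (show ¬ (sIdx 2 4 = sIdx 0 4) by decide), if_pos rfl]
      exact labne _
  exact {
    size_dom := hszd
    size_sc := hszs
    valid := by
      intro t ht; rw [htris] at ht
      simp only [List.mem_cons, List.not_mem_nil, or_false] at ht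
      rcases ht with rfl | rfl | rfl
      · exact v1
      · exact v2
      · exact v3
    mem := by
      intro t ht; rw [htris] at ht
      simp only [List.mem_cons, List.not_mem_nil, or_false] at ht
      rcases ht with rfl | rfl | rfl
      · rw [s1]; exact T1
      · rw [s2]; exact T2
      · rw [s3]; exact T3
    nodup := by rw [htris]; decide
    sc_eq := fun p q hp hq hpq => mkRoot_gsc _ hm _ hb p hp q hq hpq
    dom := fun p q hp hq hpq => by rw [hgd p q hp hq]; exact (sem p q hp hq hpq).1
    lab_side := fun p q hp hq hpq hl => by
      rw [hgd p q hp hq] at hl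
      obtain ⟨t, ht, hpt, hqt⟩ := (sem p q hp hq hpq).2 hl
      exact ⟨t, by rw [htris]; exact ht, hpt, hqt⟩
    side_lab := by
      intro t ht p hp q hq hpq
      rw [htris] at ht
      simp only [List.mem_cons, List.not_mem_nil, or_false] at ht
      have hp12 : p < 12 := by
        rcases ht with rfl | rfl | rfl
        · exact lt_of_mem_tset v1 hp
        · exact lt_of_mem_tset v2 hp
        · exact lt_of_mem_tset v3 hp
      have hq12 : q < 12 := by
        rcases ht with rfl | rfl | rfl
        · exact lt_of_mem_tset v1 hq
        · exact lt_of_mem_tset v2 hq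
        · exact lt_of_mem_tset v3 hq
      rw [hgd p q hp12 hq12]
      apply ne_of
      rcases ht with rfl | rfl | rfl
      · rw [s1] at hp hq; simp only [Finset.mem_insert, Finset.mem_singleton] at hp hq
        rcases hp with rfl | rfl | rfl <;> rcases hq with rfl | rfl | rfl <;> first | exact absurd rfl hpq | decide
      · rw [s2] at hp hq; simp only [Finset.mem_insert, Finset.mem_singleton] at hp hq
        rcases hp with rfl | rfl | rfl <;> rcases hq with rfl | rfl | rfl <;> first | exact absurd rfl hpq | decide
      · rw [s3] at hp hq; simp only [Finset.mem_insert, Finset.mem_singleton] at hp hq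
        rcases hp with rfl | rfl | rfl <;> rcases hq with rfl | rfl | rfl <;> first | exact absurd rfl hpq | decide }

/-- Under the root normalisation, the parameters read off `M` are admissible. [folklore] -/
theorem rootOK_bitsOf (G : M.Good 0 1 2 3 4) (hI : M.RootInv) : rootOK (bitsOf M) = true := by
  obtain ⟨-, -, -, -, -, -, -, -, -, -, -, -, -, -, -, -, -, T1, T2, T3, -, hpair⟩ := G
  obtain ⟨d1, d2, d3, d4, hb⟩ := bitsOf_decode M
  unfold rootOK
  simp only [d1, d2, d3, d4]
  -- not two long spokes
  have nll : ¬ (M.ty 0 3 = 1 ∧ M.ty 0 4 = 1) := by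
    rintro ⟨h3, h4⟩
    unfold KConf.ty at h3 h4
    split_ifs at h3 with g3
    split_ifs at h4 with g4
    have long_of : ∀ {x : ℕ} {t : Finset ℕ}, t ∈ M.T → (0 : ℕ) ∈ t → x ∈ t → x ≠ 0 → M.g 0 x ≠ 1 / 2 →
        ({0, x} : Finset ℕ) ∈ M.longSides := by
      intro x t ht h0t hxt hx0 hg
      unfold KConf.longSides
      rw [Finset.mem_filter, KConf.mem_sides]
      refine ⟨⟨by rw [Finset.card_pair (Ne.symm hx0)], t, ht, ?_⟩, 0, by simp, x, by simp, Ne.symm hx0, hg⟩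
      intro y hy; simp only [Finset.mem_insert, Finset.mem_singleton] at hy
      rcases hy with rfl | rfl
      · exact h0t
      · exact hxt
    have l3 := long_of T2 (by simp) (by simp) (by norm_num) g3
    have l4 := long_of T3 (by simp) (by simp) (by norm_num) g4
    exact absurd (hpair 3 4 l3 l4) (by norm_num)
  have htb := hI.2.2
  have t03 := M.ty_le_one 0 3; have t13 := M.ty_le_one 1 3; have t04 := M.ty_le_one 0 4; have t24 := M.ty_le_one 2 4
  simp only [Bool.and_eq_true, Bool.not_eq_true', Bool.and_eq_false_iff, beq_eq_false_iff_ne, ne_eq, Bool.or_eq_false_iff,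
    decide_eq_false_iff_not, not_lt]
  omega

/-- The root state of `M` is among the root states. [folklore] -/
theorem mem_rootStates (G : M.Good 0 1 2 3 4) (hI : M.RootInv) :
    (mkRoot (M.ty 1 2) (bitsOf M), [0, 1, 2, 3, 4]) ∈ rootStates := by
  unfold rootStates
  rw [List.mem_flatMap]
  have hm : M.ty 1 2 < 2 := by have := M.ty_le_one 1 2; omega
  obtain ⟨-, -, -, -, hb⟩ := bitsOf_decode M
  refine ⟨M.ty 1 2, List.mem_range.2 hm, ?_⟩
  rw [List.mem_map]
  exact ⟨bitsOf M, List.mem_filter.2 ⟨List.mem_range.2 hb, rootOK_bitsOf G hI⟩, rfl⟩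

/-- **The main abstract theorem.**  If every root state searches `true` (with some fuel), every
structure `M : KConf` has an FCC or HCP contact graph. [cite: Hales2012, Theorem 3 and Lemma 9] -/
theorem concl_of_roots {fuel : ℕ} (h : ∀ p ∈ rootStates, p.1.search p.2 fuel = true) (M : KConf) : M.Concl := by
  obtain ⟨M', hback, G, hI⟩ := M.exists_good_rootInv
  apply hback
  have hmem := mem_rootStates G hI
  have hR := realizes_mkRoot G
  refine search_sound fuel M' _ [0, 1, 2, 3, 4] hR hI (fun x hx => ?_) (h _ hmem)
  -- the labels `0 … 4` are used in the root state
  rw [mkRoot_tris]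
  obtain ⟨⟨-, s1⟩, ⟨-, s2⟩, ⟨-, s3⟩⟩ := root_codes
  interval_cases x
  · exact ⟨triCode 0 1 2, by simp, by rw [s1]; simp⟩
  · exact ⟨triCode 0 1 2, by simp, by rw [s1]; simp⟩
  · exact ⟨triCode 0 1 2, by simp, by rw [s1]; simp⟩
  · exact ⟨triCode 0 1 3, by simp, by rw [s2]; simp⟩
  · exact ⟨triCode 0 2 4, by simp, by rw [s3]; simp⟩

/-- **The main abstract theorem from the parts of the computation.** [folklore] -/
theorem concl_of_parts {depth parts fuel : ℕ} (hparts : 0 < parts)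
    (h : ∀ i, i < parts → checkPart depth parts i fuel = true) (M : KConf) : M.Concl :=
  concl_of_roots (search_roots_of_parts hparts h) M

end Main


end KissingSearch

end Literature.Geometry.DiscreteGeometry
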